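import Summits.Parity.GeneralizedHardyLittlewood.Theorems.BeyondDiagonalBeatsQuarter.OffDiagCoreLedgerSplit
import Summits.Parity.GeneralizedHardyLittlewood.Theorems.BeyondDiagonalBeatsQuarter.OffDiagCoreLedgerTail
import HarnessLib

/-!
# Route `PrimeLevelFamEdge`, crux K_B (stmt-Parity-20343), line `diagonal_kernel_split` rev 4, plan Ω,
# support kit for K1 = P8 (T) `OffDiagCoreTruncationKit`: **the first-frequency twins of K2's tail bounds and
# the per-box truncation difference `‖Σ_hΦ̂N − Σ_{|h₁|≤H}Φ̂N‖ ≤ q(r+1)·Σ_{|h₁|>H}‖Φ̂‖`**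

(T) of Ω-h v4 (`OffDiagHeartCore.offDiagBelowSlack_io_of_coreBlockAtCleanScales`) asks
`|offDiagNearHead Δ′ q − offDiagCore Hf Δ′ q| ≤ ε·ms` eventually. This kit reduces it to arithmetic:
* `tailBracket_fst_le`, **`boxTail_fst_le`**, `exists_boxTail_fst_le` — L2's first-frequency tail
  (`OffDiagDualTruncationBox.tsum_tail_norm_fourier2_boxWeight_le`, verbatim shape) on the core's ranges, with
  `H₁ = ⌈q(r+1)·D₁·q^{ε₀}/(2π)⌉`: `q(r+1)·Σ_{h∈ℤ², |h₁|>H₁} ‖Φ̂_i(h/(q(r+1)))‖ ≤ 12(18S_k + 7260√(S_{2k}S₄))·q^{61}·(q^{ε₀})^{−k}`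
  (twins of `OffDiagCoreLedgerTail.tailBracket_snd_le` / `boxTail_snd_le` by the swap `i ↦ i.swap`, `d₁ ↔ d₂`, `α ↔ β`);
* `norm_tsum_sub_trunc_le` — per box `‖Σ_hΦ̂N − Σ_{|h₁|≤H}Φ̂N‖ ≤ q r·Σ_{|h₁|>H}‖Φ̂‖` (`summable_dual`, `N ≤ qr`);
The companion `OffDiagCoreTruncationCount` turns these into `|offDiagNearHead − offDiagCore Hf| ≤ (4πq̂/q)·TAIL₁(Hf)`
and counts the index set for any box function. What is then left of (T) for `Hf_ε₀ = ⌈q c D₁ q^{ε₀}/(2π)⌉`: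
`k = ⌈74/ε₀⌉ + 2`, `q^{74} ≤ (q^{ε₀})^k`, and `PeterssonSplit.exists_qhat_rpow_le_mul_mainScaleReal`
(as in `OffDiagCoreLedger.abs_offDiagCore_le`).
Bookkeeping; nothing about the heart. Helper (`--supports stmt-Parity-20343`); standard axioms.
«The programme SEARCHES and TYPES; no claim about Landau–Siegel zeros, Theorems 1–2 of arXiv:2211.02515 or
a repaired Margin232 until a kernel theorem says so.»
-/

noncomputable section

open Finset Polynomial
open scoped Real Nat

namespace Summit.Parity.GeneralizedHardyLittlewood.Theorems.BeyondDiagonalBeatsQuarter.OffDiag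

open Literature.NumberTheory.LFunctions Literature.NumberTheory.LFunctions.KMV2000
open Literature.NumberTheory.Sieve.FriedlanderIwaniecPrimes (fourier2)
open Literature.Analysis.Calculus.WhitneyConvex (dyadicBumpBound dyadicBumpBound_nonneg)
open PeterssonSplit (nearBoxes two_pi_mul_qhat_sq qhat_sq_le)

/-! ### §1. The first-frequency twins of L2's monomial bounds -/

/-- **ONE monomial for L2's tail constant (first direction)**, in the syntactic shape of
`OffDiagDualTruncationBox.tsum_tail_norm_fourier2_boxWeight_le`: on the core's ranges the bracket is
`≤ (18S_k + 7260√(S_{2k}S₄))·q^{38}` (`tailBracket_snd_le` at `i.swap`, `d₁ ↔ d₂`, `α ↔ β`).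
[cite: KowalskiMichelVanderKam2000, Lemma 3.3 p. 9 — derivation] -/
theorem tailBracket_fst_le {q d₁ d₂ α β r : ℕ} (hq : 1 ≤ q) (hd₁ : 1 ≤ d₁) (hd₂ : 1 ≤ d₂) (hr : 1 ≤ r)
    (hαq : (α : ℝ) ≤ q) (hβq : (β : ℝ) ≤ q) {i : ℕ × ℕ} (hK₁ : (2 : ℝ) ^ i.1 ≤ (q : ℝ) ^ 5)
    (hK₂ : (2 : ℝ) ^ i.2 ≤ (q : ℝ) ^ 5) {c : ℝ} (hc0 : 0 ≤ c) (hc : c ≤ (q : ℝ) ^ 8) (k : ℕ) :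
    2 * (((3 * 2 ^ i.2 / 2) * (3 * 2 ^ i.1 / 2) *
            (∑ j ∈ Finset.range (k + 1), ((k : ℕ).choose j : ℝ) * (2 ^ j * dyadicBumpBound j) *
              ((((k - j : ℕ) : ℝ) + 1) ^ 2 * (k - j) ! * ((k - j : ℕ) : ℝ) ^ (k - j))) *
            (((d₁ : ℝ) * d₂ * (2 ^ i.2 / 2)) ^ (-(1 : ℝ) / 2) * (r : ℝ)⁻¹ * ((2 : ℝ) ^ i.1 / 2) ^ (-(1 : ℝ) / 2))) +
          π ^ 2 / 3 * (c * ((1 + 4 * π * Real.sqrt ((β : ℝ) * α * (2 * 2 ^ i.1)) / ((q : ℝ) * r) * Real.sqrt (2 * 2 ^ i.2)) /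
            ((2 : ℝ) ^ i.2 / 2)) / (2 * π)) ^ 2 *
            Real.sqrt (((3 * 2 ^ i.2 / 2) * (3 * 2 ^ i.1 / 2) *
            (∑ j ∈ Finset.range ((2 * k) + 1), (((2 * k) : ℕ).choose j : ℝ) * (2 ^ j * dyadicBumpBound j) *
              (((((2 * k) - j : ℕ) : ℝ) + 1) ^ 2 * ((2 * k) - j) ! * (((2 * k) - j : ℕ) : ℝ) ^ ((2 * k) - j))) *
            (((d₁ : ℝ) * d₂ * (2 ^ i.2 / 2)) ^ (-(1 : ℝ) / 2) * (r : ℝ)⁻¹ * ((2 : ℝ) ^ i.1 / 2) ^ (-(1 : ℝ) / 2))) *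
              ((3 * 2 ^ i.1 / 2) * (3 * 2 ^ i.2 / 2) *
            (∑ j ∈ Finset.range (4 + 1), ((4 : ℕ).choose j : ℝ) * (2 ^ j * dyadicBumpBound j) *
              ((((4 - j : ℕ) : ℝ) + 1) ^ 2 * (4 - j) ! * ((4 - j : ℕ) : ℝ) ^ (4 - j))) *
            (((d₂ : ℝ) * d₁ * (2 ^ i.1 / 2)) ^ (-(1 : ℝ) / 2) * (r : ℝ)⁻¹ * ((2 : ℝ) ^ i.2 / 2) ^ (-(1 : ℝ) / 2))))) ≤
      (18 * (∑ j ∈ Finset.range (k + 1), ((k : ℕ).choose j : ℝ) * (2 ^ j * dyadicBumpBound j) *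
              ((((k - j : ℕ) : ℝ) + 1) ^ 2 * (k - j) ! * ((k - j : ℕ) : ℝ) ^ (k - j))) +
        7260 * Real.sqrt ((∑ j ∈ Finset.range ((2 * k) + 1), (((2 * k) : ℕ).choose j : ℝ) *
              (2 ^ j * dyadicBumpBound j) *
              (((((2 * k) - j : ℕ) : ℝ) + 1) ^ 2 * ((2 * k) - j) ! * (((2 * k) - j : ℕ) : ℝ) ^ ((2 * k) - j))) *
            (∑ j ∈ Finset.range (4 + 1), ((4 : ℕ).choose j : ℝ) * (2 ^ j * dyadicBumpBound j) *
              ((((4 - j : ℕ) : ℝ) + 1) ^ 2 * (4 - j) ! * ((4 - j : ℕ) : ℝ) ^ (4 - j))))) * (q : ℝ) ^ 38 := by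
  have h := tailBracket_snd_le (d₁ := d₂) (d₂ := d₁) (α := β) (β := α) (r := r) (i := i.swap) (c := c)
    hq hd₂ hd₁ hr hβq hαq (by simpa using hK₂) (by simpa using hK₁) hc0 hc k
  simpa only [Prod.fst_swap, Prod.snd_swap] using h

/-- **Per box, first direction.** On the core's ranges, for `0 ≤ ε₀ ≤ 1`, `k ≥ 2`, with
`H₁ = ⌈q(r+1)·D₁·q^{ε₀}/(2π)⌉` (L2's first height):
`q(r+1)·Σ_{h∈ℤ², |h₁| > H₁} ‖Φ̂_i(h/(q(r+1)))‖ ≤ 12(18S_k + 7260√(S_{2k}S₄))·q^{61}·(q^{ε₀})^{−k}`.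
[cite: KowalskiMichelVanderKam2000, Lemma 3.3 p. 9 — derivation] -/
theorem boxTail_fst_le {q : ℕ} [NeZero q] (hq : 1 ≤ q) {d₁ d₂ α β : ℕ} (hd₁ : 1 ≤ d₁) (hd₂ : 1 ≤ d₂)
    (hα : 1 ≤ α) (hβ : 1 ≤ β) (hαq : (α : ℝ) ≤ q) (hβq : (β : ℝ) ≤ q) {r : ℕ} (hr : r + 1 ≤ q ^ 7)
    {i : ℕ × ℕ} (hK₁ : (2 : ℝ) ^ i.1 ≤ (q : ℝ) ^ 5) (hK₂ : (2 : ℝ) ^ i.2 ≤ (q : ℝ) ^ 5)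
    {ε₀ : ℝ} (hε₀ : 0 ≤ ε₀) (hε₁ : ε₀ ≤ 1) {k : ℕ} (hk : 2 ≤ k) :
    ((q * (r + 1) : ℕ) : ℝ) * ∑' h : ℤ × ℤ,
        (if (⌈((q * (r + 1) : ℕ) : ℝ) * ((1 + 4 * π * Real.sqrt ((α : ℝ) * β * (2 * 2 ^ i.2)) /
              ((q : ℝ) * ((r + 1 : ℕ) : ℝ)) * Real.sqrt (2 * 2 ^ i.1)) / ((2 : ℝ) ^ i.1 / 2)) / (2 * π) *
              (q : ℝ) ^ ε₀⌉₊ : ℤ) < |h.1| then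
          ‖fourier2 (boxWeight q d₁ d₂ α β (r + 1) i) (h.1 / (q * (r + 1) : ℕ)) (h.2 / (q * (r + 1) : ℕ))‖
        else 0) ≤
      12 * (18 * (∑ j ∈ Finset.range (k + 1), ((k : ℕ).choose j : ℝ) * (2 ^ j * dyadicBumpBound j) *
              ((((k - j : ℕ) : ℝ) + 1) ^ 2 * (k - j) ! * ((k - j : ℕ) : ℝ) ^ (k - j))) +
        7260 * Real.sqrt ((∑ j ∈ Finset.range ((2 * k) + 1), (((2 * k) : ℕ).choose j : ℝ) *
              (2 ^ j * dyadicBumpBound j) *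
              (((((2 * k) - j : ℕ) : ℝ) + 1) ^ 2 * ((2 * k) - j) ! * (((2 * k) - j : ℕ) : ℝ) ^ ((2 * k) - j))) *
            (∑ j ∈ Finset.range (4 + 1), ((4 : ℕ).choose j : ℝ) * (2 ^ j * dyadicBumpBound j) *
              ((((4 - j : ℕ) : ℝ) + 1) ^ 2 * (4 - j) ! * ((4 - j : ℕ) : ℝ) ^ (4 - j))))) * (q : ℝ) ^ 61 * (((q : ℝ) ^ ε₀) ^ k)⁻¹ := by
  set c : ℝ := ((q * (r + 1) : ℕ) : ℝ) with hc
  have hq1 : (1 : ℝ) ≤ q := by exact_mod_cast hq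
  have hq0 : (0 : ℝ) < q := by linarith
  have hr1 : (1 : ℝ) ≤ ((r + 1 : ℕ) : ℝ) := by exact_mod_cast Nat.succ_pos r
  have hc_eq : c = (q : ℝ) * ((r + 1 : ℕ) : ℝ) := by rw [hc]; push_cast; ring
  have hc0 : 0 < c := by rw [hc_eq]; positivity
  have hc8 : c ≤ (q : ℝ) ^ 8 := by
    have hr' : ((r + 1 : ℕ) : ℝ) ≤ (q : ℝ) ^ 7 := by exact_mod_cast hr
    calc c = (q : ℝ) * ((r + 1 : ℕ) : ℝ) := hc_eq
      _ ≤ (q : ℝ) * (q : ℝ) ^ 7 := mul_le_mul_of_nonneg_left hr' hq0.le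
      _ = (q : ℝ) ^ 8 := by ring
  have hQ1 : (1 : ℝ) ≤ (q : ℝ) ^ ε₀ := Real.one_le_rpow hq1 hε₀
  have hQq : (q : ℝ) ^ ε₀ ≤ q := by
    calc (q : ℝ) ^ ε₀ ≤ (q : ℝ) ^ (1 : ℝ) := Real.rpow_le_rpow_of_exponent_le hq1 hε₁
      _ = q := Real.rpow_one _
  have hα0 : (0 : ℝ) ≤ α := Nat.cast_nonneg _
  have hβ0 : (0 : ℝ) ≤ β := Nat.cast_nonneg _
  have hαβ : (α : ℝ) * β ≤ (q : ℝ) ^ 2 := by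
    rw [sq]; exact mul_le_mul hαq hβq hβ0 (by positivity)
  have hden : (1 : ℝ) ≤ (q : ℝ) * ((r + 1 : ℕ) : ℝ) := one_le_mul_of_one_le_of_one_le hq1 hr1
  -- the height
  set D : ℝ := c * ((1 + 4 * π * Real.sqrt ((α : ℝ) * β * (2 * 2 ^ i.2)) /
      ((q : ℝ) * ((r + 1 : ℕ) : ℝ)) * Real.sqrt (2 * 2 ^ i.1)) / ((2 : ℝ) ^ i.1 / 2)) / (2 * π) *
      (q : ℝ) ^ ε₀ with hD
  have hK₁1 : (1 : ℝ) ≤ (2 : ℝ) ^ i.1 := one_le_pow₀ (by norm_num)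
  have hK₂1 : (1 : ℝ) ≤ (2 : ℝ) ^ i.2 := one_le_pow₀ (by norm_num)
  have hD0 : 0 < D := by rw [hD]; positivity
  have hDle : D ≤ 11 * (q : ℝ) ^ 15 := by
    have h := dTerm_le (K := (2 : ℝ) ^ i.2) (K' := (2 : ℝ) ^ i.1) hq1 hα0 hβ0 hαβ (by positivity) hK₂ hK₁1
      hK₁ hden hc8
    calc D ≤ 11 * (q : ℝ) ^ 14 * q := mul_le_mul h hQq (by positivity) (by positivity)
      _ = 11 * (q : ℝ) ^ 15 := by ring
  set H : ℕ := ⌈D⌉₊ with hH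
  have hH1 : 1 ≤ H := Nat.one_le_iff_ne_zero.mpr (Nat.pos_iff_ne_zero.mp (Nat.ceil_pos.mpr hD0))
  have hHle : (H : ℝ) ≤ 12 * (q : ℝ) ^ 15 := by
    have := natCeil_le_add_one hD0.le hDle
    have h15 : (1 : ℝ) ≤ (q : ℝ) ^ 15 := one_le_pow₀ hq1
    rw [hH]; linarith
  have hlen : c * ((1 + 4 * π * Real.sqrt ((α : ℝ) * β * (2 * 2 ^ i.2)) /
      ((q : ℝ) * ((r + 1 : ℕ) : ℝ)) * Real.sqrt (2 * 2 ^ i.1)) / ((2 : ℝ) ^ i.1 / 2)) / (2 * π) *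
      (q : ℝ) ^ ε₀ ≤ H := Nat.le_ceil D
  -- L2's tail bound and the monomial
  have htail := OffDiagPoissonTwisted.tsum_tail_norm_fourier2_boxWeight_le (q := q) (r := r + 1)
    hd₁ hd₂ hα hβ i hc0 hk hH1 hQ1 hlen
  have hBR := tailBracket_fst_le (q := q) (d₁ := d₁) (d₂ := d₂) (α := α) (β := β) (r := r + 1) (i := i)
    hq hd₁ hd₂ (Nat.succ_pos r) hαq hβq hK₁ hK₂ hc0.le hc8 k
  have hQk0 : 0 ≤ (((q : ℝ) ^ ε₀) ^ k)⁻¹ := by positivity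
  have h𝓚0 : 0 ≤ 18 * (∑ j ∈ Finset.range (k + 1), ((k : ℕ).choose j : ℝ) * (2 ^ j * dyadicBumpBound j) *
              ((((k - j : ℕ) : ℝ) + 1) ^ 2 * (k - j) ! * ((k - j : ℕ) : ℝ) ^ (k - j))) + 7260 * Real.sqrt ((∑ j ∈ Finset.range ((2 * k) + 1), (((2 * k) : ℕ).choose j : ℝ) *
              (2 ^ j * dyadicBumpBound j) *
              (((((2 * k) - j : ℕ) : ℝ) + 1) ^ 2 * ((2 * k) - j) ! * (((2 * k) - j : ℕ) : ℝ) ^ ((2 * k) - j))) *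
            (∑ j ∈ Finset.range (4 + 1), ((4 : ℕ).choose j : ℝ) * (2 ^ j * dyadicBumpBound j) *
              ((((4 - j : ℕ) : ℝ) + 1) ^ 2 * (4 - j) ! * ((4 - j : ℕ) : ℝ) ^ (4 - j)))) := by
    have h1 : 0 ≤ (∑ j ∈ Finset.range (k + 1), ((k : ℕ).choose j : ℝ) * (2 ^ j * dyadicBumpBound j) *
              ((((k - j : ℕ) : ℝ) + 1) ^ 2 * (k - j) ! * ((k - j : ℕ) : ℝ) ^ (k - j))) := Finset.sum_nonneg fun j _ ↦ by
      have := dyadicBumpBound_nonneg j; positivity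
    positivity
  calc c * _ ≤ (q : ℝ) ^ 8 * ((18 * (∑ j ∈ Finset.range (k + 1), ((k : ℕ).choose j : ℝ) * (2 ^ j * dyadicBumpBound j) *
              ((((k - j : ℕ) : ℝ) + 1) ^ 2 * (k - j) ! * ((k - j : ℕ) : ℝ) ^ (k - j))) + 7260 * Real.sqrt ((∑ j ∈ Finset.range ((2 * k) + 1), (((2 * k) : ℕ).choose j : ℝ) *
              (2 ^ j * dyadicBumpBound j) *
              (((((2 * k) - j : ℕ) : ℝ) + 1) ^ 2 * ((2 * k) - j) ! * (((2 * k) - j : ℕ) : ℝ) ^ ((2 * k) - j))) *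
            (∑ j ∈ Finset.range (4 + 1), ((4 : ℕ).choose j : ℝ) * (2 ^ j * dyadicBumpBound j) *
              ((((4 - j : ℕ) : ℝ) + 1) ^ 2 * (4 - j) ! * ((4 - j : ℕ) : ℝ) ^ (4 - j))))) * (q : ℝ) ^ 38 * H * (((q : ℝ) ^ ε₀) ^ k)⁻¹) := by
        refine mul_le_mul hc8 (htail.trans ?_) (tsum_nonneg fun h ↦ by split_ifs <;> positivity)
          (by positivity)
        exact mul_le_mul_of_nonneg_right (mul_le_mul_of_nonneg_right hBR (Nat.cast_nonneg _)) hQk0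
    _ ≤ (q : ℝ) ^ 8 * ((18 * (∑ j ∈ Finset.range (k + 1), ((k : ℕ).choose j : ℝ) * (2 ^ j * dyadicBumpBound j) *
              ((((k - j : ℕ) : ℝ) + 1) ^ 2 * (k - j) ! * ((k - j : ℕ) : ℝ) ^ (k - j))) + 7260 * Real.sqrt ((∑ j ∈ Finset.range ((2 * k) + 1), (((2 * k) : ℕ).choose j : ℝ) *
              (2 ^ j * dyadicBumpBound j) *
              (((((2 * k) - j : ℕ) : ℝ) + 1) ^ 2 * ((2 * k) - j) ! * (((2 * k) - j : ℕ) : ℝ) ^ ((2 * k) - j))) *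
            (∑ j ∈ Finset.range (4 + 1), ((4 : ℕ).choose j : ℝ) * (2 ^ j * dyadicBumpBound j) *
              ((((4 - j : ℕ) : ℝ) + 1) ^ 2 * (4 - j) ! * ((4 - j : ℕ) : ℝ) ^ (4 - j))))) * (q : ℝ) ^ 38 * (12 * (q : ℝ) ^ 15) *
          (((q : ℝ) ^ ε₀) ^ k)⁻¹) := by
        gcongr
    _ = 12 * (18 * (∑ j ∈ Finset.range (k + 1), ((k : ℕ).choose j : ℝ) * (2 ^ j * dyadicBumpBound j) *
              ((((k - j : ℕ) : ℝ) + 1) ^ 2 * (k - j) ! * ((k - j : ℕ) : ℝ) ^ (k - j))) +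
        7260 * Real.sqrt ((∑ j ∈ Finset.range ((2 * k) + 1), (((2 * k) : ℕ).choose j : ℝ) *
              (2 ^ j * dyadicBumpBound j) *
              (((((2 * k) - j : ℕ) : ℝ) + 1) ^ 2 * ((2 * k) - j) ! * (((2 * k) - j : ℕ) : ℝ) ^ ((2 * k) - j))) *
            (∑ j ∈ Finset.range (4 + 1), ((4 : ℕ).choose j : ℝ) * (2 ^ j * dyadicBumpBound j) *
              ((((4 - j : ℕ) : ℝ) + 1) ^ 2 * (4 - j) ! * ((4 - j : ℕ) : ℝ) ^ (4 - j))))) * (q : ℝ) ^ 61 * (((q : ℝ) ^ ε₀) ^ k)⁻¹ := by ring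

/-- The same with the constant packaged (`𝓚 ≥ 0` depends on `k` only).
[cite: KowalskiMichelVanderKam2000, Lemma 3.3 p. 9 — derivation] -/
theorem exists_boxTail_fst_le {k : ℕ} (hk : 2 ≤ k) {ε₀ : ℝ} (hε₀ : 0 ≤ ε₀) (hε₁ : ε₀ ≤ 1) :
    ∃ 𝓚 : ℝ, 0 ≤ 𝓚 ∧ ∀ (q : ℕ) [NeZero q] (d₁ d₂ α β r : ℕ) (i : ℕ × ℕ), 1 ≤ q → 1 ≤ d₁ → 1 ≤ d₂ →
      1 ≤ α → 1 ≤ β → (α : ℝ) ≤ q → (β : ℝ) ≤ q → r + 1 ≤ q ^ 7 → (2 : ℝ) ^ i.1 ≤ (q : ℝ) ^ 5 →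
      (2 : ℝ) ^ i.2 ≤ (q : ℝ) ^ 5 →
      ((q * (r + 1) : ℕ) : ℝ) * ∑' h : ℤ × ℤ,
        (if (⌈((q * (r + 1) : ℕ) : ℝ) * ((1 + 4 * π * Real.sqrt ((α : ℝ) * β * (2 * 2 ^ i.2)) /
              ((q : ℝ) * ((r + 1 : ℕ) : ℝ)) * Real.sqrt (2 * 2 ^ i.1)) / ((2 : ℝ) ^ i.1 / 2)) / (2 * π) *
              (q : ℝ) ^ ε₀⌉₊ : ℤ) < |h.1| then
          ‖fourier2 (boxWeight q d₁ d₂ α β (r + 1) i) (h.1 / (q * (r + 1) : ℕ)) (h.2 / (q * (r + 1) : ℕ))‖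
        else 0) ≤ 𝓚 * (q : ℝ) ^ 61 * (((q : ℝ) ^ ε₀) ^ k)⁻¹ := by
  refine ⟨12 * (18 * (∑ j ∈ Finset.range (k + 1), ((k : ℕ).choose j : ℝ) * (2 ^ j * dyadicBumpBound j) *
              ((((k - j : ℕ) : ℝ) + 1) ^ 2 * (k - j) ! * ((k - j : ℕ) : ℝ) ^ (k - j))) +
        7260 * Real.sqrt ((∑ j ∈ Finset.range ((2 * k) + 1), (((2 * k) : ℕ).choose j : ℝ) *
              (2 ^ j * dyadicBumpBound j) *
              (((((2 * k) - j : ℕ) : ℝ) + 1) ^ 2 * ((2 * k) - j) ! * (((2 * k) - j : ℕ) : ℝ) ^ ((2 * k) - j))) *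
            (∑ j ∈ Finset.range (4 + 1), ((4 : ℕ).choose j : ℝ) * (2 ^ j * dyadicBumpBound j) *
              ((((4 - j : ℕ) : ℝ) + 1) ^ 2 * (4 - j) ! * ((4 - j : ℕ) : ℝ) ^ (4 - j))))), ?_, ?_⟩
  · have h1 : 0 ≤ (∑ j ∈ Finset.range (k + 1), ((k : ℕ).choose j : ℝ) * (2 ^ j * dyadicBumpBound j) *
              ((((k - j : ℕ) : ℝ) + 1) ^ 2 * (k - j) ! * ((k - j : ℕ) : ℝ) ^ (k - j))) := Finset.sum_nonneg fun j _ ↦ by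
      have := dyadicBumpBound_nonneg j; positivity
    positivity
  · intro q _ d₁ d₂ α β r i hq hd₁ hd₂ hα hβ hαq hβq hr hK₁ hK₂
    exact boxTail_fst_le hq hd₁ hd₂ hα hβ hαq hβq hr hK₁ hK₂ hε₀ hε₁ hk

/-! ### §2. One box: the truncation difference -/

section Box

variable {q d₁ d₂ α β : ℕ}

/-- **Per box.** `‖Σ_{h∈ℤ²} Φ̂_i N − Σ_{|h₁| ≤ H} Φ̂_i N‖ ≤ (qr)·Σ_{h∈ℤ², |h₁| > H} ‖Φ̂_i(h/(qr))‖`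
(the difference is the `|h₁| > H` tail; `N ≤ qr`). [folklore] -/
theorem norm_tsum_sub_trunc_le [NeZero q] (hd₁ : 1 ≤ d₁) (hd₂ : 1 ≤ d₂) (hα : 1 ≤ α) (hβ : 1 ≤ β)
    (r : ℕ) [NeZero (q * r)] (i : ℕ × ℕ) (H : ℕ) :
    ‖(∑' h : ℤ × ℤ, fourier2 (boxWeight q d₁ d₂ α β r i) (h.1 / (q * r : ℕ)) (h.2 / (q * r : ℕ)) *
          (dualCount (q * r) (α : ZMod (q * r)) (β : ZMod (q * r)) (h.1 : ZMod (q * r)) (h.2 : ZMod (q * r)) : ℂ)) -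
      ∑' h : ℤ × ℤ, (if |h.1| ≤ (H : ℤ) then
        fourier2 (boxWeight q d₁ d₂ α β r i) (h.1 / (q * r : ℕ)) (h.2 / (q * r : ℕ)) *
          (dualCount (q * r) (α : ZMod (q * r)) (β : ZMod (q * r)) (h.1 : ZMod (q * r)) (h.2 : ZMod (q * r)) : ℂ)
        else 0)‖ ≤
      ((q * r : ℕ) : ℝ) * ∑' h : ℤ × ℤ, (if (H : ℤ) < |h.1| then
          ‖fourier2 (boxWeight q d₁ d₂ α β r i) (h.1 / (q * r : ℕ)) (h.2 / (q * r : ℕ))‖ else 0) := by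
  classical
  set c : ℕ := q * r with hc
  have hc0 : (0 : ℝ) < (c : ℝ) := by exact_mod_cast Nat.pos_of_ne_zero (NeZero.ne (q * r))
  set F : ℤ × ℤ → ℂ := fun h ↦ fourier2 (boxWeight q d₁ d₂ α β r i) (h.1 / (c : ℕ)) (h.2 / (c : ℕ)) with hF
  set N : ℤ × ℤ → ℕ := fun h ↦
    dualCount c (α : ZMod c) (β : ZMod c) (h.1 : ZMod c) (h.2 : ZMod c) with hN
  have hsum : Summable fun h : ℤ × ℤ ↦ F h * (N h : ℂ) := summable_dual (q := q) (r := r) hd₁ hd₂ hα hβ i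
  have hsF : Summable fun h : ℤ × ℤ ↦ ‖F h‖ :=
    (OffDiagPoissonTwisted.summable_fourier2_lattice_of_contDiff
      (contDiff_uncurry_boxWeight (q := q) (r := r) hd₁ hd₂ hα hβ i)
      (hasCompactSupport_uncurry_boxWeight (q := q) (d₁ := d₁) (d₂ := d₂) (α := α) (β := β) (r := r) i)
      hc0).norm
  have hNle : ∀ h : ℤ × ℤ, ((N h : ℕ) : ℝ) ≤ (c : ℝ) := fun h ↦ by
    exact_mod_cast dualCount_le _ _ _ _
  -- truncated and tail pieces
  set f₁ : ℤ × ℤ → ℂ := fun h ↦ if |h.1| ≤ (H : ℤ) then F h * (N h : ℂ) else 0 with hf₁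
  set f₂ : ℤ × ℤ → ℂ := fun h ↦ if (H : ℤ) < |h.1| then F h * (N h : ℂ) else 0 with hf₂
  have hsplit : ∀ h, F h * (N h : ℂ) = f₁ h + f₂ h := fun h ↦ by
    simp only [hf₁, hf₂]
    by_cases h1 : |h.1| ≤ (H : ℤ)
    · rw [if_pos h1, if_neg (not_lt.mpr h1), add_zero]
    · rw [if_neg h1, if_pos (not_le.mp h1), zero_add]
  have hf₁s : Summable f₁ := by
    refine Summable.of_norm_bounded (g := fun h ↦ ‖F h * (N h : ℂ)‖) hsum.norm fun h ↦ ?_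
    simp only [hf₁]; split_ifs
    · exact le_rfl
    · rw [norm_zero]; exact norm_nonneg _
  have hf₂s : Summable f₂ := by
    refine Summable.of_norm_bounded (g := fun h ↦ ‖F h * (N h : ℂ)‖) hsum.norm fun h ↦ ?_
    simp only [hf₂]; split_ifs
    · exact le_rfl
    · rw [norm_zero]; exact norm_nonneg _
  have hdiff : (∑' h, F h * (N h : ℂ)) - ∑' h, f₁ h = ∑' h, f₂ h := by
    rw [tsum_congr hsplit, hf₁s.tsum_add hf₂s]; ring
  -- the tail against `c·Σ‖Φ̂‖`
  set g : ℤ × ℤ → ℝ := fun h ↦ (c : ℝ) * (if (H : ℤ) < |h.1| then ‖F h‖ else 0) with hg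
  have hgs : Summable g := by
    refine (hsF.mul_left (c : ℝ)).of_nonneg_of_le (fun h ↦ by positivity) fun h ↦ ?_
    simp only [hg]
    split_ifs
    · exact le_rfl
    · exact mul_le_mul_of_nonneg_left (norm_nonneg _) hc0.le
  have hpt : ∀ h, ‖f₂ h‖ ≤ g h := fun h ↦ by
    simp only [hf₂, hg]
    split_ifs
    · rw [norm_mul, Complex.norm_natCast, mul_comm (c : ℝ)]
      exact mul_le_mul_of_nonneg_left (hNle h) (norm_nonneg _)
    · rw [norm_zero]; positivity
  have hf₂n : Summable fun h ↦ ‖f₂ h‖ := hf₂s.norm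
  rw [hdiff]
  calc ‖∑' h, f₂ h‖ ≤ ∑' h, ‖f₂ h‖ := norm_tsum_le_tsum_norm hf₂n
    _ ≤ ∑' h, g h := hf₂n.tsum_le_tsum hpt hgs
    _ = _ := by simp only [hg]; exact tsum_mul_left

end Box

end Summit.Parity.GeneralizedHardyLittlewood.Theorems.BeyondDiagonalBeatsQuarter.OffDiag
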